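import Mathlib
import HarnessLib
import Summits.HubbardSuperconductivity.HubbardSuperconductivity.Theorems.KLProgrammeH10TwoPointLimitSectorMultiplierL1

/-!
# Route `KLProgramme` — engine support, route (L2): the ISOTROPIC single-multiplier symbol on an admissible frame — the angular factor
# `Z₁ = sq·sq·(R·ζ̃_{2m,ω})`, the continuum symbol `Φ₁ = G_m(k₀² + e_K²)·Z₁`, and the identification of the PADDED multiplier
# `[val q₁ < 2M]·klIsoFamily … m ω (⟨val q₁⟩, q₂)` on `(ℤ/4M) × (ℤ/L)²` with the sample of `Φ₁`

Cell `gate-hubbard-kl`, seat p4 (C5a lead), g7; plan g13 GO «p4: type T̂_iso» (the `hT` input of p3's `isoTupleL1AtS_zero_of_klEng`,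
(E5-S)₀ of `stub_engine_scale0`, ENGINE stmt-HubbardSuperconductivity-19918).  Single-factor twin of `…SymbolAngularFactor` /
`…SymbolFrameInstance` (which are PAIR-shaped): for `F = klIsoFamily … e₀ m ω` (radial `C_{−m}⁻¹`, angular `ζ̃_{2m,ω}`),

* `isoAngularFactor_props` (C², `≤ 1`, support, zone — bundled), `isoAngularFactor_line_eventuallyEq`,
  `abs_derivs_isoAngularFactor_line_le` (`|∂ₛZ₁| ≤ 2B·D`, `|∂ₛ²Z₁| ≤ 2B·D²`, `D = (1 + 2/w_{2m})‖w₁+iw₂‖`, from `abs_iteratedDeriv_plateaued_line_le`);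
* **`klIso_padded_eq_symbol`** — on ALL of `(ℤ/4M) × (ℤ/L)²`: the padded multiplier IS `Φ₁(π(1−2M)/β + (2π/β)val q₁, (2π/L)q̃₂)` (inside
  `val q₁ < 2M` by the frame dictionary, beyond it both sides vanish: the padded frequencies exceed the window, `Λ_mβ < π(2M−3)`);
* `isoSymbol_zone_cell` (zone; cell radius `(Λ_m + s_max Dt_min(3w_{2m}/4))/(Dt_min − 2A) ∝ Λ_m` — the iso cell), `isoSymbol_window4`
  (the window sits two steps inside `ℤ/4M`).

Everything is proved; no definitions, no named facts. [cite: BenfattoGiulianiMastropietro2006, §2.5 (2.45)–(2.48), (2.57)]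
-/

noncomputable section

namespace Summit.HubbardSuperconductivity.HubbardSuperconductivity.Theorems.TorusFourierL2

set_option linter.dupNamespace false -- summit = problem name (single-conjunct summit), D-0017

open Set Filter Topology Literature.MathematicalPhysics.QuantumLattice Literature.MathematicalPhysics.QuantumLattice.BandSectorCounting
open Literature.MathematicalPhysics.QuantumLattice.FermiRG Literature.Probability.LatticeModels Literature.Analysis.SpecialFunctions
open Summit.HubbardSuperconductivity.HubbardSuperconductivity.Theorems.DispersionFlow
open Summit.HubbardSuperconductivity.HubbardSuperconductivity.Theorems.KLRegimeSplit
open Summit.HubbardSuperconductivity.HubbardSuperconductivity.Theorems.KLProgrammeLegKernels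
open Summit.HubbardSuperconductivity.HubbardSuperconductivity.Theorems.PerturbedFermiCurve
open scoped Real

/-! ### §1 The single angular factor -/

section Angular

variable {z : ℝ} {na : ℕ} {ω₁ : ℤ} {Z : (Fin 2 → ℝ) → ℝ}
  (hZ : ∀ p, Z p = gnCutoff ((π + z) ^ 2 / π ^ 2) ((π + z) ^ 2) (p 0 ^ 2) * gnCutoff ((π + z) ^ 2 / π ^ 2) ((π + z) ^ 2) (p 1 ^ 2) *
    (radialCutoffC (1 / 2) (momToComplex p) * sectorWeightCirc na ω₁ (polarAngle p)))
include hZ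

/-- **The single angular factor**: smooth, `|Z₁| ≤ 1`, supported where `ζ̃_{na,ω}(θ) ≠ 0`, vanishing as soon as some `|p_j| ≥ π + z`
(`z > 0`). [folklore] -/
theorem isoAngularFactor_props (hz : 0 < z) :
    ContDiff ℝ 2 Z ∧ (∀ p, |Z p| ≤ 1) ∧ (∀ p, Z p ≠ 0 → sectorWeightCirc na ω₁ (polarAngle p) ≠ 0) ∧
      (∀ p : Fin 2 → ℝ, (∃ j, π + z ≤ |p j|) → Z p = 0) := by
  have hfun : Z = fun p => gnCutoff ((π + z) ^ 2 / π ^ 2) ((π + z) ^ 2) (p 0 ^ 2) * gnCutoff ((π + z) ^ 2 / π ^ 2) ((π + z) ^ 2) (p 1 ^ 2) *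
      (radialCutoffC (1 / 2) (momToComplex p) * sectorWeightCirc na ω₁ (polarAngle p)) := funext hZ
  have hg : ∀ t : ℝ, 0 ≤ gnCutoff ((π + z) ^ 2 / π ^ 2) ((π + z) ^ 2) t ∧ gnCutoff ((π + z) ^ 2 / π ^ 2) ((π + z) ^ 2) t ≤ 1 :=
    fun t => ⟨(gnCutoff_mem_Icc _ _ t).1, (gnCutoff_mem_Icc _ _ t).2⟩
  have hA : ∀ p : Fin 2 → ℝ, 0 ≤ radialCutoffC (1 / 2) (momToComplex p) * sectorWeightCirc na ω₁ (polarAngle p) ∧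
      radialCutoffC (1 / 2) (momToComplex p) * sectorWeightCirc na ω₁ (polarAngle p) ≤ 1 := fun p =>
    ⟨mul_nonneg (radialCutoffC_mem_Icc _ _).1 (sectorWeightCirc_nonneg _ _ _),
      mul_le_one₀ (radialCutoffC_mem_Icc _ _).2 (sectorWeightCirc_nonneg _ _ _) (sectorWeightCirc_le_one _ _ _)⟩
  refine ⟨?_, fun p => ?_, fun p h => ?_, fun p ⟨j, hj⟩ => ?_⟩
  · rw [hfun]
    have hb : ∀ j : Fin 2, ContDiff ℝ 2 fun p : Fin 2 → ℝ => gnCutoff ((π + z) ^ 2 / π ^ 2) ((π + z) ^ 2) (p j ^ 2) := fun j =>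
      (contDiff_gnCutoff _ _).comp ((contDiff_apply ℝ ℝ j).pow 2)
    exact ((hb 0).mul (hb 1)).mul (contDiff_radial_mul_sectorWeightCirc_polarAngle (by norm_num) na ω₁)
  · rw [hZ, abs_le]
    constructor
    · have : 0 ≤ gnCutoff ((π + z) ^ 2 / π ^ 2) ((π + z) ^ 2) (p 0 ^ 2) * gnCutoff ((π + z) ^ 2 / π ^ 2) ((π + z) ^ 2) (p 1 ^ 2) *
          (radialCutoffC (1 / 2) (momToComplex p) * sectorWeightCirc na ω₁ (polarAngle p)) :=
        mul_nonneg (mul_nonneg (hg _).1 (hg _).1) (hA p).1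
      linarith
    · exact mul_le_one₀ (mul_le_one₀ (hg _).2 (hg _).1 (hg _).2) (hA p).1 (hA p).2
  · rw [hZ] at h
    obtain ⟨-, h2⟩ := mul_ne_zero_iff.1 h
    exact (mul_ne_zero_iff.1 h2).2
  · have hπz : 0 ≤ π + z := by linarith [Real.pi_pos]
    have hsq : (π + z) ^ 2 ≤ p j ^ 2 := by
      rw [← sq_abs (p j)]; exact pow_le_pow_left₀ hπz hj 2
    rw [hZ]
    fin_cases j
    · rw [sqCutoff_eq_zero hz (by simpa using hsq)]; ring
    · rw [mul_comm (gnCutoff _ _ (p 0 ^ 2)), sqCutoff_eq_zero hz (by simpa using hsq)]; ring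

/-- Near a point of the open square the square cutoffs are invisible: along any line `σ ↦ Z₁(p₀ + σ•w)` agrees near `s` with the
plateaued angular factor. [folklore] -/
theorem isoAngularFactor_line_eventuallyEq (hz : 0 < z) (p₀ w : Fin 2 → ℝ) {s : ℝ} (hsq : ∀ i, |(p₀ + s • w) i| < π) :
    (fun σ : ℝ => Z (p₀ + σ • w)) =ᶠ[𝓝 s] fun σ =>
      radialCutoffC (1 / 2) (momToComplex (p₀ + σ • w)) * sectorWeightCirc na ω₁ (polarAngle (p₀ + σ • w)) := by
  have hcont : ∀ i : Fin 2, Continuous fun σ : ℝ => (p₀ + σ • w) i := fun i => by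
    simp only [Pi.add_apply, Pi.smul_apply, smul_eq_mul]; fun_prop
  have hopen : ∀ i : Fin 2, ∀ᶠ σ in 𝓝 s, |(p₀ + σ • w) i| < π := fun i =>
    (continuous_abs.comp (hcont i)).continuousAt.eventually_lt continuousAt_const (hsq i)
  filter_upwards [hopen 0, hopen 1] with σ h0 h1
  rw [hZ]
  have e0 : gnCutoff ((π + z) ^ 2 / π ^ 2) ((π + z) ^ 2) ((p₀ + σ • w) 0 ^ 2) = 1 :=
    sqCutoff_eq_one hz (by rw [← sq_abs]; exact pow_le_pow_left₀ (abs_nonneg _) h0.le 2)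
  have e1 : gnCutoff ((π + z) ^ 2 / π ^ 2) ((π + z) ^ 2) ((p₀ + σ • w) 1 ^ 2) = 1 :=
    sqCutoff_eq_one hz (by rw [← sq_abs]; exact pow_le_pow_left₀ (abs_nonneg _) h1.le 2)
  rw [e0, e1, one_mul, one_mul]

/-- **Line derivatives of the single angular factor on the Fermi region of the open square**: with `D = (1 + 2/w_{na})‖w₁ + iw₂‖`,
`|∂ₛ Z₁| ≤ 2B·D` and `|∂ₛ² Z₁| ≤ 2B·D²`. [cite: BenfattoGiulianiMastropietro2006, §2.5 Lemma 2.2] -/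
theorem abs_derivs_isoAngularFactor_line_le (hz : 0 < z) {B : ℝ}
    (hB : ∀ (i : ℕ), i ≤ 2 → ∀ (n : ℕ) (ω : ℤ) (θ₀ : ℝ) (q w : Fin 2 → ℝ) (t : ℝ) {r₀ : ℝ}, 0 < r₀ →
      r₀ ≤ ‖momToComplex (q + t • w)‖ → |sectorRelAngle θ₀ (q + t • w)| < π →
      ‖iteratedDeriv i (fun t : ℝ => sectorWeightCirc n ω (polarAngle (q + t • w))) t‖ ≤
        (2 : ℕ).factorial * B * ((1 + (sectorWidth n)⁻¹ * (2 : ℕ).factorial) * ‖momToComplex w‖ / r₀) ^ i)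
    (p₀ w : Fin 2 → ℝ) {s : ℝ} (hsq : ∀ i, |(p₀ + s • w) i| < π) (hfermi : 1 ≤ ‖momToComplex (p₀ + s • w)‖) :
    |deriv (fun σ : ℝ => Z (p₀ + σ • w)) s| ≤ 2 * B * ((1 + 2 * (sectorWidth na)⁻¹) * ‖momToComplex w‖) ∧
      |iteratedDeriv 2 (fun σ : ℝ => Z (p₀ + σ • w)) s| ≤ 2 * B * ((1 + 2 * (sectorWidth na)⁻¹) * ‖momToComplex w‖) ^ 2 := by
  have hev := isoAngularFactor_line_eventuallyEq hZ hz p₀ w hsq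
  constructor
  · rw [hev.deriv_eq]
    have h := abs_iteratedDeriv_plateaued_line_le hB na ω₁ p₀ w hfermi (i := 1) (by norm_num)
    rw [iteratedDeriv_one, pow_one] at h; exact h
  · rw [hev.iteratedDeriv_eq]
    exact abs_iteratedDeriv_plateaued_line_le hB na ω₁ p₀ w hfermi (i := 2) le_rfl

end Angular

/-! ### §2 The isotropic symbol on a frame and the padded multiplier on `(ℤ/4M) × (ℤ/L)²` -/

section Instance

variable {L M : ℕ} [NeZero L] [NeZero M] {a b : ℝ} (B : BandBounds a b) {K : TrigPolyC4v} {A : ℝ}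
  (hA : ∀ p : Momentum, ∀ j ≤ 2, ‖iteratedFDeriv ℝ j (frameShift K) p‖ ≤ A) (hADt : 2 * A < B.Dtmin)
  {μ e₀ z β : ℝ} (he : 0 < e₀) (hz : 0 < z) (hz1 : z ≤ 1) (hgap : e₀ + A + z ^ 2 < -μ) (h3 : e₀ + A - μ ≤ 3)
  (hlo : a ≤ μ - A - e₀) (hhi : μ + A + e₀ ≤ b) (hβ : 0 < β)
  {m : ℕ} (ω : Fin (sectorCount (2 * m)))
  {Z : (Fin 2 → ℝ) → ℝ}
  (hZ : ∀ p, Z p = gnCutoff ((π + z) ^ 2 / π ^ 2) ((π + z) ^ 2) (p 0 ^ 2) * gnCutoff ((π + z) ^ 2 / π ^ 2) ((π + z) ^ 2) (p 1 ^ 2) *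
    (radialCutoffC (1 / 2) (momToComplex p) * sectorWeightCirc (2 * m) ((ω : ℕ) : ℤ) (polarAngle p)))
  {Φ : ℝ × (Fin 2 → ℝ) → ℂ}
  (hΦ : ∀ k₀ p, Φ (k₀, p) = ((bgmCutoffSq e₀ ((16 : ℝ) ^ m * (k₀ ^ 2 + frameLevel μ K (WithLp.toLp 2 p) ^ 2)) * Z p : ℝ) : ℂ))
  {Gs : TorusSite 1 (2 * (2 * M)) × TorusSite 2 L → ℂ}
  (hGs : ∀ q, Gs q = if h : (q.1 0).val < 2 * M then klIsoFamily L M β μ K e₀ m ω (⟨(q.1 0).val, h⟩, q.2) else 0)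

omit [NeZero M] in
/-- The padded Matsubara frequency of a column `q₁ ∈ ℤ/4M` with `val q₁ < 2M` is the Matsubara frequency of `⟨val q₁⟩`. [folklore] -/
theorem matsubaraFreq_val_eq (q₁ : TorusSite 1 (2 * (2 * M))) (h : (q₁ 0).val < 2 * M) :
    matsubaraFreq β M (⟨(q₁ 0).val, h⟩ : MatsubaraIdx M) = π * (1 - 2 * M) / β + 2 * π / β * (((q₁ 0).val : ℕ) : ℝ) := by
  simp only [matsubaraFreq, matsubaraInt]
  push_cast
  ring

include hβ in
omit [NeZero M] in
/-- **Beyond the kept block the padded frequencies are outside the window**: for `val q₁ ≥ 2M` and `Λβ < π(2M−3)`,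
`Λ < |π(1−2M)/β + (2π/β) val q₁|`. [folklore] -/
theorem window_of_le_val {Λ : ℝ} (hM : Λ * β < π * (2 * M - 3)) (q₁ : TorusSite 1 (2 * (2 * M))) (h : 2 * M ≤ (q₁ 0).val) :
    Λ < |π * (1 - 2 * M) / β + 2 * π / β * (((q₁ 0).val : ℕ) : ℝ)| := by
  have hπ := Real.pi_pos
  have hv : (2 * (M : ℝ)) ≤ (((q₁ 0).val : ℕ) : ℝ) := by exact_mod_cast h
  have e : π * (1 - 2 * M) / β + 2 * π / β * (((q₁ 0).val : ℕ) : ℝ) = π * (2 * (((q₁ 0).val : ℕ) : ℝ) + 1 - 2 * M) / β := by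
    field_simp; ring
  rw [e, abs_of_pos (by apply div_pos _ hβ; nlinarith), lt_div_iff₀ hβ]
  nlinarith

include hA h3 he hz hβ hZ hΦ hGs in
omit [NeZero M] in
/-- **The padded isotropic multiplier IS the sample of the continuum symbol** on all of `(ℤ/4M) × (ℤ/L)²`: for `Λ_m β < π(2M − 3)`,
`Gs q = Φ₁(π(1−2M)/β + (2π/β) val q₁, (2π/L) q̃₂)`. [cite: BenfattoGiulianiMastropietro2006, §2.5 (2.57)] -/
theorem klIso_padded_eq_symbol (hM : klScale e₀ m * β < π * (2 * M - 3)) (q : TorusSite 1 (2 * (2 * M)) × TorusSite 2 L) :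
    Gs q = Φ (π * (1 - 2 * M) / β + 2 * π / β * (((q.1 0).val : ℕ) : ℝ), fun j => 2 * π / L * (((q.2 j).valMinAbs : ℤ) : ℝ)) := by
  rw [hGs]
  set c : Fin 2 → ℝ := torusCentredMomentum L q.2 with hc
  have hcval : c = fun j => 2 * π / L * (((q.2 j).valMinAbs : ℤ) : ℝ) := torusCentredMomentum_eq_valMinAbs q.2
  have he_eq : nambuXiCT L μ K q.2 = frameLevel μ K (WithLp.toLp 2 c) := nambuXiCT_eq_frameLevel L μ K q.2
  have hang : momentumAngle L q.2 = polarAngle c := rfl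
  have hΛ : 0 < klScale e₀ m := by rw [klScale]; positivity
  split_ifs with h
  · -- inside the kept block: the frame dictionary
    rw [← hcval, hΦ, klIsoFamily, klIsoMultiplier, matsubaraFreq_val_eq q.1 h, he_eq, hang]
    set k₀ : ℝ := π * (1 - 2 * M) / β + 2 * π / β * (((q.1 0).val : ℕ) : ℝ) with hk₀
    set u : ℝ := k₀ ^ 2 + frameLevel μ K (WithLp.toLp 2 c) ^ 2 with hu
    congr 1
    -- the square cutoff is `1` at the sample point
    have hcπ : ∀ j, |c j| ≤ π := abs_torusCentredMomentum_le_pi L q.2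
    have hsq : ∀ j, gnCutoff ((π + z) ^ 2 / π ^ 2) ((π + z) ^ 2) (c j ^ 2) = 1 := fun j =>
      sqCutoff_eq_one hz (by rw [← sq_abs]; exact pow_le_pow_left₀ (abs_nonneg _) (hcπ j) 2)
    rw [hZ c, hsq 0, hsq 1, one_mul, one_mul]
    by_cases hR : (1 : ℝ) / 2 ≤ ‖momToComplex c‖
    · rw [radialCutoffC_eq_one (by norm_num) hR, one_mul, gnScaleCutoff_sqrt_eq_bgmCutoffSq]
    · have hnot : ¬ (1 : ℝ) ≤ ‖momToComplex c‖ := fun h1 => hR (by linarith)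
      have hbig : e₀ < |frameLevel μ K (WithLp.toLp 2 c)| := by
        by_contra hle
        exact hnot (one_le_norm_of_frameBand_le hA h3 (not_lt.1 hle))
      have h1 : gnScaleCutoff 4 e₀ (-(m : ℤ)) (Real.sqrt u) = 0 := gnScaleCutoff_eq_zero_of_band_gt he m hbig
      have h1' : bgmCutoffSq e₀ ((16 : ℝ) ^ m * u) = 0 := by rw [← gnScaleCutoff_sqrt_eq_bgmCutoffSq]; exact h1
      rw [h1, h1']; ring
  · -- beyond it both sides vanish
    push Not at h
    rw [← hcval, hΦ]
    have hwin := window_of_le_val hβ hM q.1 h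
    have hu : klScale e₀ m ^ 2 < (π * (1 - 2 * M) / β + 2 * π / β * (((q.1 0).val : ℕ) : ℝ)) ^ 2 +
        frameLevel μ K (WithLp.toLp 2 c) ^ 2 := by
      have h1 : klScale e₀ m ^ 2 < (π * (1 - 2 * M) / β + 2 * π / β * (((q.1 0).val : ℕ) : ℝ)) ^ 2 := by
        have := sq_lt_sq' (by linarith [abs_nonneg (π * (1 - 2 * M) / β + 2 * π / β * (((q.1 0).val : ℕ) : ℝ))]) hwin
        rwa [sq_abs] at this
      nlinarith
    obtain ⟨d, -, hd1, hd2⟩ := exists_abs_derivs_bgmCutoffSq_le he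
    rw [(scaleProfile_bounds he m hd1 hd2).2.2.2.2 _ hu]; simp

include B hA hADt hz hz1 hgap he hlo hhi hΦ hZ in
/-- **Zone and cell of the isotropic symbol**: (i) `Φ₁(k₀, p) = 0` as soon as some `|p_j| ≥ π − z`; (ii) a point of the square-with-margin
in the shell `|e_K| ≤ Λ_m` with `Z₁ ≠ 0` is within `(Λ_m + s_max Dt_min (3w_{2m}/4))/(Dt_min − 2A)` of `klFermiPoint μ K θ_{2m,ω}` (sup norm)
— a radius `∝ Λ_m` since `w_{2m} = πΛ_m/e₀` (the iso cell). [cite: BenfattoGiulianiMastropietro2006, §2.5 (2.57)] -/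
theorem isoSymbol_zone_cell :
    (∀ (k₀ : ℝ) (p : Fin 2 → ℝ), (∃ j, π - z ≤ |p j|) → Φ (k₀, p) = 0) ∧
    (∀ p : Fin 2 → ℝ, (∀ i, |p i| ≤ π + z) → |frameLevel μ K (WithLp.toLp 2 p)| ≤ klScale e₀ m → Z p ≠ 0 →
      ‖p - klFermiPoint μ K (sectorCenter (2 * m) (ω : ℕ))‖ ≤
        (klScale e₀ m + B.smax * B.Dtmin * (3 * sectorWidth (2 * m) / 4)) / (B.Dtmin - 2 * A)) := by
  obtain ⟨-, -, hsupp, hzone⟩ := isoAngularFactor_props hZ hz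
  refine ⟨fun k₀ p ⟨j, hj⟩ => ?_, fun p hsq hshell hZp => ?_⟩
  · rw [hΦ]
    rcases le_or_gt (π + z) |p j| with hfar | hnear
    · rw [hzone p ⟨j, hfar⟩]; simp
    · have hband : e₀ < |frameLevel μ K (WithLp.toLp 2 p)| := frameBand_zone hA hz1 hgap hj hnear.le
      have hu : klScale e₀ m ^ 2 < k₀ ^ 2 + frameLevel μ K (WithLp.toLp 2 p) ^ 2 := by
        have h1 := klScale_le_e0 he.le m
        have h2 : 0 < klScale e₀ m := by rw [klScale]; positivity
        have h3' : e₀ ^ 2 < frameLevel μ K (WithLp.toLp 2 p) ^ 2 := by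
          have := sq_lt_sq' (by linarith [abs_nonneg (frameLevel μ K (WithLp.toLp 2 p))]) hband
          rwa [sq_abs] at this
        nlinarith [pow_le_pow_left₀ h2.le h1 2, sq_nonneg k₀]
      obtain ⟨d, -, hd1, hd2⟩ := exists_abs_derivs_bgmCutoffSq_le he
      rw [(scaleProfile_bounds he m hd1 hd2).2.2.2.2 _ hu]; simp
  · have hΛ := klScale_le_e0 he.le m
    exact frameBand_cell B hA hADt hz.le hz1 (by linarith) (by linarith) (by linarith) (2 * m) (ω : ℕ) hsq hshell (hsupp p hZp)

include hβ in
omit [NeZero M] in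
/-- **Window on `ℤ/4M`**: if `Λβ < π(2M − 3)` then `Λ < |π(1−2M)/β + (2π/β) mm|` for all integers `mm < 2` and `mm ≥ 4M − 2`. [folklore] -/
theorem isoSymbol_window4 {Λ : ℝ} (hM : Λ * β < π * (2 * M - 3)) (hM1 : 1 ≤ M) (mm : ℤ)
    (hm : mm < 2 ∨ ((2 * (2 * M) : ℕ) : ℤ) ≤ mm + 2) : Λ < |π * (1 - 2 * M) / β + 2 * π / β * (mm : ℝ)| := by
  have hπ := Real.pi_pos
  have e : π * (1 - 2 * M) / β + 2 * π / β * (mm : ℝ) = π * (2 * (mm : ℝ) + 1 - 2 * M) / β := by field_simp; ring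
  rw [e, abs_div, abs_of_pos hβ, lt_div_iff₀ hβ, abs_mul, abs_of_pos hπ]
  refine lt_of_lt_of_le hM (mul_le_mul_of_nonneg_left ?_ hπ.le)
  rcases hm with hm | hm
  · have hm' : (mm : ℝ) ≤ 1 := by exact_mod_cast (by omega : mm ≤ 1)
    rw [le_abs]; right; linarith
  · have hm' : (4 * (M : ℝ)) - 2 ≤ (mm : ℝ) := by
      have : (4 * M : ℤ) - 2 ≤ mm := by push_cast at hm ⊢; omega
      exact_mod_cast this
    have hM' : (1 : ℝ) ≤ M := by exact_mod_cast hM1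
    rw [le_abs]; left; linarith

end Instance

end Summit.HubbardSuperconductivity.HubbardSuperconductivity.Theorems.TorusFourierL2

end
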